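import Literature.MathematicalPhysics.QuantumFieldTheory.Balaban1983to89.T3ConstrainedMinimiser
import HarnessLib

/-!
# `Balaban1983to89.T3DescentFibreTower` — rung R3, crux K1, child «MinimiserStability» (cell DAG node N6b «K1-E-min»): the
# STRUCTURE of the descent fibres behind `T3ConstrainedMinimiser.minAction` — descent transitivity `D_{n,K} ∘ D_{K,K'} = D_{n,K'}`,
# the fibre tower `minAction_{n,K'}(V) = inf {minAction_{K,K'}(W) : W ∈ fibre_{n,K}(V)}`, and the trivial configuration
# (`blockAvg ℰ 1 = 1` at the printed smearing, so `1 ∈ fibre(1)` and `minAction (1) = 0`)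

Cell `ym3-torus` (HUMAN RULING D-0037, YM ladder rung R3), seat `ym3-torus-p1` gen 4 (UV side).  WHAT THIS IS NOT: not d = 4,
not a mass gap, not Clay, and no estimate: everything here is PROVED bookkeeping about the objects `fibre` / `minAction` of
`T3ConstrainedMinimiser` (p408691) and `descendTo` of `T3TiltDescent` (p407213); the analytic schemas and their composition into
`MinimiserStabilityAt` are the sibling module `T3MinimiserStabilityReduction`.

* §1 **`descendTo_descendTo`**: `D_{n,K}(D_{K,K'}U) = D_{n,K'}U` (`n ≤ K ≤ K'`; [Balaban1987RG1] (0.11) `Ū^{k} = M^{k}(U)` across the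
  towers, as `T3TiltDescent.unitA_descendTo`: `iterFrom_fieldShift` + `iter_add`); `descendTo_self`.
* §2 **the fibre tower**: fibres compose and descend (`mem_fibre_trans`, `descendTo_mem_fibre`), `fibre_eq_biUnion`
  (the `(n,K')`-fibre is the union over the `(n,K)`-fibre of the one-step fibres), `fibre_self`/`minAction_self`, and
  **`minAction_tower`**: under the surjectivity of `D_{K,K'}` (hypothesis `hne`), `minAction_{n,K'}(V) = inf_{W ∈ fibre_{n,K}(V)}
  minAction_{K,K'}(W)` — the two-cut-off comparison of `MinimiserStabilityAt` is a ONE-STEP statement along the fibre.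
* §3 **the trivial configuration**: `holAt 1 = 1`, `axialAvg 1 = 1`, the loop variables of (0.4) are `1`, hence `avgFun ℰ 1 = 1` for
  every small-loop average with `E(1,…,1) = 1` — in particular the printed `exp[mean log]` (`expMeanLogSU_E_one`) — so
  `descendTo 1 = 1`, `1 ∈ fibre(1)`, `wilsonAction4 1 = 0`, **`minAction (1) = 0`**, and `PlaqSmall δ 1` for `δ > 0`.

References: T. Bałaban, CMP 109 (1987) 249 [Balaban1987RG1] ((0.4), (0.11) p.253); CMP 102 (1985) 255 [Balaban1985UV3] ((41)–(42)
p.266: the nested variational problems); CMP 98 (1985) 17 [Balaban1985Averaging] ((9) p.19).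
-/

noncomputable section

open MeasureTheory Filter Topology
open Literature.MathematicalPhysics.QuantumFieldTheory.Balaban1983to89.T3ContinuumYM3Torus
open Literature.MathematicalPhysics.QuantumFieldTheory.Balaban1983to89.T3LevelShift
open Literature.MathematicalPhysics.QuantumFieldTheory.Balaban1983to89.T3UnitLawDensityEML (ℰp measurableE_ℰp)
open Literature.MathematicalPhysics.QuantumFieldTheory.Balaban1983to89.T3UnitScaleTilt
open Literature.MathematicalPhysics.QuantumFieldTheory.Balaban1983to89.T3TiltDescent
open Literature.MathematicalPhysics.QuantumFieldTheory.Balaban1983to89.T3CruxEstimates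
open Literature.MathematicalPhysics.QuantumFieldTheory.Balaban1983to89.T3ConstrainedMinimiser
open Literature.MathematicalPhysics.QuantumFieldTheory.Balaban1983to89.Missing
open Literature.MathematicalPhysics.QuantumFieldTheory.Balaban1983to89.T4Continuum

namespace Literature.MathematicalPhysics.QuantumFieldTheory.Balaban1983to89.T3DescentFibreTower

/-! ## §1 Descent transitivity: `D_{n,K} ∘ D_{K,K'} = D_{n,K'}` -/

section Descent

variable (F : T3Family) {G : Type*} [GaugeGroup G] (ℰ : LoopAverage G)

/-- Reindexing an iterated averaging along a propositional equality of the number of steps (local helper, as in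
`T3TiltDescent`). [folklore] -/
private theorem fieldShift_iter_of_eq {K a b : ℕ} (hab : a = b) (U : GaugeField (F.PP F.m K) 0 G) :
    fieldShift (F.sitesPerDir_eq (m := F.m) (K := K) (j := a) (m' := F.m) (K' := K) (j' := b) (by omega))
        (Averaging.iter (fun i => BlockAveraging.blockAvg (P := F.PP F.m K) (j := i) ℰ) b U) =
      Averaging.iter (fun i => BlockAveraging.blockAvg (P := F.PP F.m K) (j := i) ℰ) a U := by
  subst hab
  exact fieldShift_refl _ _

/-- **DESCENT TRANSITIVITY `D_{n,K}(D_{K,K'}U) = D_{n,K'}U`** (`n ≤ K ≤ K'`): averaging `K' − K` times on the `K'`-th tower, reading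
the result as the finest field of the `K`-th tower and averaging `K − n` more times there IS averaging `K' − n` times on the
`K'`-th tower ([Balaban1987RG1] (0.11) `Ū^{k} = M^{k}(U)` across the towers: `iterFrom_fieldShift` + `iter_add`). [cite: Balaban1987RG1, (0.11) p.253] -/
theorem descendTo_descendTo {n K K' : ℕ} (h₁ : n ≤ K) (h₂ : K ≤ K') (U : GaugeField (F.P K') 0 G) :
    descendTo F ℰ n K h₁ (descendTo F ℰ K K' h₂ U) = descendTo F ℰ n K' (h₁.trans h₂) U := by
  show fieldShift _ (Averaging.iter (fun i => BlockAveraging.blockAvg (P := F.PP F.m K) (j := i) ℰ) (K - n)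
      (fieldShift _ (Averaging.iter (fun i => BlockAveraging.blockAvg (P := F.PP F.m K') (j := i) ℰ) (K' - K) U))) =
    fieldShift _ (Averaging.iter (fun i => BlockAveraging.blockAvg (P := F.PP F.m K') (j := i) ℰ) (K' - n) U)
  rw [← iterFrom_fieldShift ℰ (show F.m + K' = F.m + K + (K' - K) by omega) (K - n), fieldShift_fieldShift,
    ← T4AvgSensitivity.iter_add, ← fieldShift_iter_of_eq F ℰ (show K' - n = K' - K + (K - n) by omega) U,
    fieldShift_fieldShift]

/-- `D_{K,K} = id`. [cite: Balaban1987RG1, (0.11) p.253] -/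
theorem descendTo_self (K : ℕ) (U : GaugeField (F.P K) 0 G) : descendTo F ℰ K K le_rfl U = U := by
  show fieldShift _ (Averaging.iter (fun i => BlockAveraging.blockAvg (P := F.PP F.m K) (j := i) ℰ) (K - K) U) = U
  rw [fieldShift_iter_of_eq F ℰ (show 0 = K - K by omega) U]
  rfl

end Descent

/-! ## §2 The fibre tower -/

section Tower

variable (F : T3Family) {G : Type*} [GaugeGroup G] (ℰ : LoopAverage G)

/-- Membership in a fibre, unfolded (definitional). [cite: Balaban1985UV3, (41) p.266] -/
theorem mem_fibre_iff {n K : ℕ} {h : n ≤ K} {V : GaugeField (F.P n) 0 G} {U : GaugeField (F.P K) 0 G} :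
    U ∈ fibre F ℰ n K h V ↔ descendTo F ℰ n K h U = V := Iff.rfl

/-- **Fibres compose**: a one-step preimage of an element of the `(n,K)`-fibre of `V` lies in the `(n,K')`-fibre of `V`.
[cite: Balaban1987RG1, (0.11) p.253] -/
theorem mem_fibre_trans {n K K' : ℕ} (h₁ : n ≤ K) (h₂ : K ≤ K') {V : GaugeField (F.P n) 0 G}
    {U : GaugeField (F.P K) 0 G} {U' : GaugeField (F.P K') 0 G}
    (hU' : U' ∈ fibre F ℰ K K' h₂ U) (hU : U ∈ fibre F ℰ n K h₁ V) : U' ∈ fibre F ℰ n K' (h₁.trans h₂) V := by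
  rw [mem_fibre_iff] at hU' hU ⊢
  rw [← descendTo_descendTo F ℰ h₁ h₂, hU', hU]

/-- **Fibres descend**: the one-step average of an element of the `(n,K')`-fibre of `V` lies in the `(n,K)`-fibre of `V`.
[cite: Balaban1987RG1, (0.11) p.253] -/
theorem descendTo_mem_fibre {n K K' : ℕ} (h₁ : n ≤ K) (h₂ : K ≤ K') {V : GaugeField (F.P n) 0 G}
    {U' : GaugeField (F.P K') 0 G} (hU' : U' ∈ fibre F ℰ n K' (h₁.trans h₂) V) :
    descendTo F ℰ K K' h₂ U' ∈ fibre F ℰ n K h₁ V := by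
  rw [mem_fibre_iff] at hU' ⊢
  rw [descendTo_descendTo]
  exact hU'

/-- **THE `(n,K')`-FIBRE IS THE UNION OVER THE `(n,K)`-FIBRE OF THE ONE-STEP FIBRES** (`n ≤ K ≤ K'`). [cite: Balaban1987RG1, (0.11) p.253] -/
theorem fibre_eq_biUnion {n K K' : ℕ} (h₁ : n ≤ K) (h₂ : K ≤ K') (V : GaugeField (F.P n) 0 G) :
    fibre F ℰ n K' (h₁.trans h₂) V = ⋃ W ∈ fibre F ℰ n K h₁ V, fibre F ℰ K K' h₂ W := by
  ext U'
  simp only [Set.mem_iUnion]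
  constructor
  · intro hU'
    exact ⟨_, descendTo_mem_fibre F ℰ h₁ h₂ hU', rfl⟩
  · rintro ⟨W, hW, hU'⟩
    exact mem_fibre_trans F ℰ h₁ h₂ hU' hW

/-- The trivial fibre: `fibre_{K,K}(V) = {V}`. [cite: Balaban1985UV3, (41) p.266] -/
theorem fibre_self (K : ℕ) (V : GaugeField (F.P K) 0 G) : fibre F ℰ K K le_rfl V = {V} := by
  ext U
  rw [mem_fibre_iff, descendTo_self, Set.mem_singleton_iff]

/-- Hence `minAction_{K,K}(V) = A(V)`. [cite: Balaban1985UV3, (41) p.266] -/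
theorem minAction_self (K : ℕ) (V : GaugeField (F.P K) 0 G) : minAction F ℰ K K le_rfl V = wilsonAction4 V := by
  unfold minAction
  rw [fibre_self, Set.image_singleton, csInf_singleton]

/-- **THE FIBRE TOWER OF THE CONSTRAINED MINIMAL ACTION**: if every configuration of run `K` is a `(K'−K)`-fold block average
(`hne`, the surjectivity of `D_{K,K'}`), then `minAction_{n,K'}(V) = inf {minAction_{K,K'}(W) : W ∈ fibre_{n,K}(V)}` — the
`(n,K')`-problem is the `(n,K)`-problem for the functional «one-step constrained minimum» ([Balaban1985UV3] p.266: the `k`-th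
variational problem nests the previous ones; printed cousin for linear minimisers: Bałaban–Jaffe 1986 (2.48) `H_n = H^{(n)}H_{n−1}`).
[cite: Balaban1985UV3, (41)-(42) p.266] -/
theorem minAction_tower {n K K' : ℕ} (h₁ : n ≤ K) (h₂ : K ≤ K')
    (hne : ∀ W : GaugeField (F.P K) 0 G, (fibre F ℰ K K' h₂ W).Nonempty) (V : GaugeField (F.P n) 0 G) :
    minAction F ℰ n K' (h₁.trans h₂) V = sInf ((fun W => minAction F ℰ K K' h₂ W) '' fibre F ℰ n K h₁ V) := by
  have hbddS : BddBelow ((fun W => minAction F ℰ K K' h₂ W) '' fibre F ℰ n K h₁ V) :=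
    ⟨0, by rintro _ ⟨W, _, rfl⟩; exact minAction_nonneg F ℰ W⟩
  by_cases hV : (fibre F ℰ n K h₁ V).Nonempty
  · obtain ⟨W₀, hW₀⟩ := hV
    obtain ⟨U₀, hU₀⟩ := hne W₀
    have hT : ((fun U => wilsonAction4 U) '' fibre F ℰ n K' (h₁.trans h₂) V).Nonempty :=
      ⟨_, U₀, mem_fibre_trans F ℰ h₁ h₂ hU₀ hW₀, rfl⟩
    refine le_antisymm (le_csInf ⟨_, W₀, hW₀, rfl⟩ ?_) (le_csInf hT ?_)
    · rintro _ ⟨W, hW, rfl⟩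
      exact le_csInf ((hne W).image _) (by
        rintro _ ⟨U', hU', rfl⟩
        exact minAction_le F ℰ (mem_fibre_trans F ℰ h₁ h₂ hU' hW))
    · rintro _ ⟨U', hU', rfl⟩
      calc sInf ((fun W => minAction F ℰ K K' h₂ W) '' fibre F ℰ n K h₁ V)
          ≤ minAction F ℰ K K' h₂ (descendTo F ℰ K K' h₂ U') :=
            csInf_le hbddS ⟨_, descendTo_mem_fibre F ℰ h₁ h₂ hU', rfl⟩
        _ ≤ wilsonAction4 U' := minAction_le F ℰ rfl
  · have hS : (fun W => minAction F ℰ K K' h₂ W) '' fibre F ℰ n K h₁ V = ∅ := by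
      rw [Set.image_eq_empty]; exact Set.not_nonempty_iff_eq_empty.mp hV
    have hT : (fun U => wilsonAction4 U) '' fibre F ℰ n K' (h₁.trans h₂) V = ∅ := by
      rw [Set.image_eq_empty, ← Set.not_nonempty_iff_eq_empty]
      rintro ⟨U', hU'⟩
      exact hV ⟨_, descendTo_mem_fibre F ℰ h₁ h₂ hU'⟩
    rw [hS, Real.sInf_empty]
    unfold minAction
    rw [hT, Real.sInf_empty]

end Tower

/-! ## §3 The trivial configuration: `blockAvg ℰ 1 = 1`, `minAction 1 = 0`, the constants `κ_K` are idle -/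

section Trivial

variable {P : Params} {j : ℕ} {G : Type*} [GaugeGroup G]

/-- Holonomies of the trivial configuration are trivial. [cite: Balaban1985Averaging, (9) p.19] -/
theorem holAt_one (γ : List (LStep P j)) : holAt (1 : GaugeField P j G) γ = 1 := by
  induction γ with
  | nil => exact holAt_nil _
  | cons s γ ih =>
    rw [holAt_cons, ih, mul_one]
    show (if s.fwd then (1 : G) else (1 : G)⁻¹) = 1
    rw [inv_one]
    split_ifs <;> rfl

/-- Straight transporters of the trivial configuration are trivial. [cite: Balaban1984PropagatorsI, (1.7) p.18] -/
theorem pathProd_one (c : PBond P (j+1)) : ∀ n : ℕ, AveragingRT.pathProd (1 : GaugeField P j G) c n = 1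
  | 0 => rfl
  | n + 1 => by
    rw [AveragingRT.pathProd, pathProd_one c n]
    exact one_mul (1 : G)

/-- The axial average of the trivial configuration is trivial. [cite: Balaban1984PropagatorsI, (1.7) p.18] -/
theorem axialAvg_one : AveragingRT.axialAvg (1 : GaugeField P j G) = 1 :=
  funext fun c => pathProd_one c P.L

/-- The loop variables of (0.4) of the trivial configuration are trivial. [cite: Balaban1987RG1, (0.4) p.253] -/
theorem loopHol_one (c : PBond P (j+1)) (i : BlockAveraging.Idx P) :
    BlockAveraging.loopHol (1 : GaugeField P j G) c i = 1 :=
  holAt_one _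

/-- The trivial configuration is in the small-field domain of (0.4) at every bond. [cite: Balaban1987RG1, (0.4) p.253] -/
theorem small_one (ℰ : LoopAverage G) (c : PBond P (j+1)) : BlockAveraging.Small ℰ (1 : GaugeField P j G) c := fun i => by
  rw [loopHol_one, GaugeGroup.dist1_one]
  exact ℰ.δ_pos

/-- **`Ū = 1` FOR `U = 1`** for every small-loop average whose value on the constant family `1` is `1` (the printed
`exp[mean log]`: `expMeanLogSU_E_one`; the trivial average: `rfl`). [cite: Balaban1987RG1, (0.4) p.253] -/
theorem avgFun_one (ℰ : LoopAverage G) (hE : ∀ n : ℕ, ℰ.E (fun _ : Fin (n + 1) => (1 : G)) = 1) :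
    BlockAveraging.avgFun ℰ (1 : GaugeField P j G) = 1 := by
  funext c
  show BlockAveraging.corr ℰ 1 c * AveragingRT.axialAvg 1 c = 1
  have hl : BlockAveraging.loopHol (1 : GaugeField P j G) c = fun _ => 1 := funext (loopHol_one c)
  rw [axialAvg_one, BlockAveraging.corr, if_pos (small_one ℰ c), hl]
  show ℰ.avg (fun _ => (1 : G)) * (1 : G) = 1
  rw [mul_one]
  exact hE _

open scoped Matrix.Norms.L2Operator in
/-- The printed small-loop average of a constant family `1` is `1` (`exp[mean log 1] = exp 0`). [cite: Balaban1987RG1, (0.4) p.253] -/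
theorem expMeanLogSU_E_one {N : Type*} [Fintype N] [DecidableEq N] [Nonempty N] (n : ℕ) :
    (ExpMeanLog.expMeanLogSU (n := N)).E (fun _ : Fin (n + 1) => (1 : Matrix.specialUnitaryGroup N ℂ)) = 1 := by
  show ExpMeanLog.ESU (fun _ : Fin (n + 1) => (1 : Matrix.specialUnitaryGroup N ℂ)) = 1
  have h : ∀ i : Fin (n + 1),
      ‖(((fun _ => (1 : Matrix.specialUnitaryGroup N ℂ)) i : Matrix.specialUnitaryGroup N ℂ) : Matrix N N ℂ) - 1‖
        < ExpMeanLog.deltaSU N := fun i => by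
    simp only [OneMemClass.coe_one, sub_self, norm_zero]
    exact ExpMeanLog.deltaSU_pos
  apply Subtype.ext
  rw [ExpMeanLog.coe_ESU_of_small h, ExpMeanLog.eml_eq_exp]
  simp

variable (F : T3Family) (ℰ : LoopAverage G)

/-- `D_{n,K} 1 = 1` for every small-loop average with `E(1,…,1) = 1`. [cite: Balaban1987RG1, (0.11) p.253] -/
theorem descendTo_one (hE : ∀ n : ℕ, ℰ.E (fun _ : Fin (n + 1) => (1 : G)) = 1) {n K : ℕ} (h : n ≤ K) :
    descendTo F ℰ n K h (1 : GaugeField (F.P K) 0 G) = 1 := by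
  have hiter : ∀ k : ℕ, Averaging.iter (fun i => BlockAveraging.blockAvg (P := F.P K) (j := i) ℰ) k
      (1 : GaugeField (F.P K) 0 G) = 1 := by
    intro k
    induction k with
    | zero => rfl
    | succ k ih =>
      show (BlockAveraging.blockAvg ℰ).avg (Averaging.iter (fun i => BlockAveraging.blockAvg (P := F.P K) (j := i) ℰ) k 1) = 1
      rw [ih, BlockAveraging.blockAvg_avg, avgFun_one ℰ hE]
  show fieldShift _ (Averaging.iter (fun i => BlockAveraging.blockAvg (P := F.P K) (j := i) ℰ) (K - n) 1) = 1
  rw [hiter]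
  rfl

/-- Hence `1 ∈ fibre_{n,K}(1)`. [cite: Balaban1985UV3, (41) p.266] -/
theorem one_mem_fibre_one (hE : ∀ n : ℕ, ℰ.E (fun _ : Fin (n + 1) => (1 : G)) = 1) {n K : ℕ} (h : n ≤ K) :
    (1 : GaugeField (F.P K) 0 G) ∈ fibre F ℰ n K h 1 :=
  descendTo_one F ℰ hE h

/-- Plaquette variables of the trivial configuration (as the tree's `T4SmallFieldWindowSandwich.plaqHol_one`, outside this file's
import cone; local helper). [cite: Balaban1985Averaging, (9) p.19] -/
private theorem plaqHol_one' (p : Plaq P j) : GaugeField.plaqHol (1 : GaugeField P j G) p = 1 := by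
  show (1 : G) * 1 * (1 : G)⁻¹ * (1 : G)⁻¹ = 1
  simp

/-- **`minAction_{n,K}(1) = 0`**: the trivial configuration is in the fibre of itself and has zero Wilson action (each term
`1 − Re tr 1 = 0`), and constrained minima are `≥ 0`. [cite: Balaban1985UV3, (41) p.266] -/
theorem minAction_one (hE : ∀ n : ℕ, ℰ.E (fun _ : Fin (n + 1) => (1 : G)) = 1) {n K : ℕ} (h : n ≤ K) :
    minAction F ℰ n K h (1 : GaugeField (F.P n) 0 G) = 0 := by
  have h0 : wilsonAction4 (1 : GaugeField (F.P K) 0 G) = 0 := by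
    unfold wilsonAction4 wilsonAction
    refine Finset.sum_eq_zero fun p _ => ?_
    rw [plaqHol_one', GaugeGroup.reTr_one, sub_self, mul_zero]
  exact le_antisymm ((minAction_le F ℰ (descendTo_one F ℰ hE h)).trans_eq h0) (minAction_nonneg F ℰ _)

/-- The trivial configuration is `δ`-small for every `δ > 0` (as the tree's `T4SmallFieldWindowSandwich.plaqSmallOn_one`, for
`PlaqSmall`). [cite: Balaban1987RG1, (0.18) p.255] -/
theorem plaqSmall_one {δ : ℝ} (hδ : 0 < δ) : PlaqSmall δ (1 : GaugeField P j G) := fun p => by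
  rw [plaqHol_one', GaugeGroup.dist1_one]; exact hδ

end Trivial

end Literature.MathematicalPhysics.QuantumFieldTheory.Balaban1983to89.T3DescentFibreTower

end
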